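import Mathlib.Analysis.Convex.SpecificFunctions.Deriv
import Mathlib.Analysis.SpecialFunctions.Trigonometric.Basic
import Mathlib.Topology.Order.IntermediateValue
import Mathlib.Topology.Algebra.Module.Basic
import HarnessLib

/-!
# Geometry of the free Fermi curve of the square-lattice dispersion at small filling

Topic `Literature/MathematicalPhysics/QuantumLattice`.  The starting point of the sector analysis of
Benfatto–Giuliani–Mastropietro 2006 (§1, (1.4)–(1.5): "if `0 < μ < 2`, then `Σ_F^{(0)}` is a smooth
convex closed curve, symmetric around `k = (0,0)` … parameterized as `k = p_F^{(0)}(θ)` in terms of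
the polar angle"; and the hypothesis `μ < (2-√2)/2` of Thm. 1.1, under which the Fermi curve is so
small that momentum conservation excludes umklapp for clusters with `|P_v| ≤ 8`, §2.5) is the
elementary geometry of the level sets of the dispersion.  In the tree's convention (hopping `1`,
`ε(k) = -2(cos k₁ + cos k₂)`, band `[-4, 4]`, BGM's range being `-4 < μ < -2 - √2`, cf.
`HubbardFermiLiquid.lean`) this file proves:

* `abs_lt_pi_div_four_of_sqDispersion_eq` — for `-4 < μ < -2 - √2` the Fermi curve
  `{ε = μ} ∩ [-π, π]²` lies in the open box `|kᵢ| < π/4`; `lt_sqDispersion_of_exists_abs_eq` — on the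
  boundary of that box `ε > μ`;
* `strictConvexOn_sqDispersion` — `ε` is strictly convex on the box `[-π/2, π/2]²` (strict concavity
  of `cos`), hence (`sqDispersion_smul_lt`) the Fermi sea is **star-shaped**: `ε(t k) < μ` for
  `0 ≤ t < 1` and `k` on the Fermi curve;
* `existsUnique_fermiRadius` — **polar parametrisation**: every direction `v` (sup-normalised,
  `maxᵢ |vᵢ| = 1`) meets the Fermi curve in exactly one point `t v`, `0 < t < π/4`.

Everything is proved; no named fact. [folklore]

## Sources

G. Benfatto, A. Giuliani, V. Mastropietro, Ann. Henri Poincaré 7 (2006), §1 (1.4)–(1.5) and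
Thm. 1.1 (the range of `μ`), §2.5 (the remark on `|P_v| ≤ 8`) (`BenfattoGiulianiMastropietro2006`).
-/

noncomputable section

open Real Set

namespace Literature.MathematicalPhysics.QuantumLattice

/-- The square-lattice dispersion with hopping `1`: `ε(k) = -2 (cos k₁ + cos k₂)`. [folklore] -/
def sqDispersion (k : Fin 2 → ℝ) : ℝ := -2 * (Real.cos (k 0) + Real.cos (k 1))

/-- The bottom of the band: `ε ≥ -4`. [folklore] -/
theorem neg_four_le_sqDispersion (k : Fin 2 → ℝ) : -4 ≤ sqDispersion k := by
  have h0 := Real.cos_le_one (k 0); have h1 := Real.cos_le_one (k 1)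
  unfold sqDispersion; linarith

/-- `ε(0) = -4`. [folklore] -/
@[simp] theorem sqDispersion_zero : sqDispersion 0 = -4 := by
  simp [sqDispersion]; norm_num

/-- Continuity of the dispersion. [folklore] -/
theorem continuous_sqDispersion : Continuous sqDispersion := by
  unfold sqDispersion; fun_prop

/-! ### The Fermi curve is small: it lies in the box `|kᵢ| < π/4` -/

/-- From `cos a > cos (π/4)` and `|a| ≤ π` conclude `|a| < π/4`. [folklore] -/
theorem abs_lt_pi_div_four_of_cos_gt {a : ℝ} (ha : |a| ≤ π) (h : Real.cos (π / 4) < Real.cos a) : |a| < π / 4 := by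
  have h' : Real.cos (π / 4) < Real.cos |a| := by rwa [Real.cos_abs]
  have hmem1 : |a| ∈ Icc (0 : ℝ) π := ⟨abs_nonneg a, ha⟩
  have hmem2 : π / 4 ∈ Icc (0 : ℝ) π := ⟨by positivity, by linarith [Real.pi_pos]⟩
  exact (Real.strictAntiOn_cos.lt_iff_gt hmem2 hmem1).1 h'

/-- **The Fermi curve lies in the box `|kᵢ| < π/4`** for `-4 < μ < -2 - √2` (fundamental domain
`|kᵢ| ≤ π`): each `cos kᵢ ≥ -μ/2 - 1 > √2/2 = cos (π/4)`. [cite: BenfattoGiulianiMastropietro2006, Thm. 1.1 and §2.5] -/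
theorem abs_lt_pi_div_four_of_sqDispersion_eq {μ : ℝ} (hμ : μ < -2 - Real.sqrt 2) {k : Fin 2 → ℝ}
    (hk : ∀ i, |k i| ≤ π) (he : sqDispersion k = μ) (i : Fin 2) : |k i| < π / 4 := by
  have h0 := Real.cos_le_one (k 0); have h1 := Real.cos_le_one (k 1)
  unfold sqDispersion at he
  refine abs_lt_pi_div_four_of_cos_gt (hk i) ?_
  rw [Real.cos_pi_div_four]
  fin_cases i
  · show Real.sqrt 2 / 2 < Real.cos (k 0); linarith
  · show Real.sqrt 2 / 2 < Real.cos (k 1); linarith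

/-- **On the boundary of the box the dispersion exceeds `μ`**: if some `|kᵢ| = π/4` then
`ε(k) ≥ -2 - √2 > μ`. [folklore] -/
theorem lt_sqDispersion_of_exists_abs_eq {μ : ℝ} (hμ : μ < -2 - Real.sqrt 2) {k : Fin 2 → ℝ}
    (hk : ∃ i, |k i| = π / 4) : μ < sqDispersion k := by
  obtain ⟨i, hi⟩ := hk
  have hcos : Real.cos (k i) = Real.sqrt 2 / 2 := by rw [← Real.cos_abs, hi, Real.cos_pi_div_four]
  have h0 := Real.cos_le_one (k 0); have h1 := Real.cos_le_one (k 1)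
  unfold sqDispersion
  fin_cases i
  · change Real.cos (k 0) = Real.sqrt 2 / 2 at hcos; linarith
  · change Real.cos (k 1) = Real.sqrt 2 / 2 at hcos; linarith

/-! ### Strict convexity on the box `[-π/2, π/2]²` and star-shapedness of the Fermi sea -/

/-- The box `[-π/2, π/2]²`. [folklore] -/
def halfBox : Set (Fin 2 → ℝ) := {k | ∀ i, k i ∈ Icc (-(π / 2)) (π / 2)}

/-- Membership in the box. [folklore] -/
theorem mem_halfBox {k : Fin 2 → ℝ} : k ∈ halfBox ↔ ∀ i, k i ∈ Icc (-(π / 2)) (π / 2) := Iff.rfl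

/-- The box is convex. [folklore] -/
theorem convex_halfBox : Convex ℝ halfBox := by
  intro x hx y hy a b ha hb hab i
  have h1 := mul_le_mul_of_nonneg_left (hx i).1 ha
  have h2 := mul_le_mul_of_nonneg_left (hy i).1 hb
  have h3 := mul_le_mul_of_nonneg_left (hx i).2 ha
  have h4 := mul_le_mul_of_nonneg_left (hy i).2 hb
  simp only [Pi.add_apply, Pi.smul_apply, smul_eq_mul, mem_Icc]
  constructor <;> nlinarith

/-- **The dispersion is strictly convex on `[-π/2, π/2]²`** (strict concavity of `cos` on
`[-π/2, π/2]` in each variable). [folklore] -/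
theorem strictConvexOn_sqDispersion : StrictConvexOn ℝ halfBox sqDispersion := by
  refine ⟨convex_halfBox, ?_⟩
  intro x hx y hy hxy a b ha hb hab
  rw [mem_halfBox] at hx hy
  have hcc := strictConcaveOn_cos_Icc
  -- coordinatewise (non-strict) concavity of `cos`
  have hle : ∀ i, a * Real.cos (x i) + b * Real.cos (y i) ≤ Real.cos (a * x i + b * y i) := fun i =>
    hcc.concaveOn.2 (hx i) (hy i) ha.le hb.le hab
  -- some coordinate differs, and there the inequality is strict
  have hne : ∃ i, x i ≠ y i := by
    by_contra h
    exact hxy (funext fun i => not_not.1 (not_exists.1 h i))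
  obtain ⟨i, hi⟩ := hne
  have hlt : a * Real.cos (x i) + b * Real.cos (y i) < Real.cos (a * x i + b * y i) := hcc.2 (hx i) (hy i) hi ha hb hab
  simp only [sqDispersion, Pi.add_apply, Pi.smul_apply, smul_eq_mul]
  fin_cases i
  · have h1 := hle 1
    change a * Real.cos (x 0) + b * Real.cos (y 0) < Real.cos (a * x 0 + b * y 0) at hlt
    nlinarith
  · have h0 := hle 0
    change a * Real.cos (x 1) + b * Real.cos (y 1) < Real.cos (a * x 1 + b * y 1) at hlt
    nlinarith

/-- `0 ∈ [-π/2, π/2]²`. [folklore] -/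
theorem zero_mem_halfBox : (0 : Fin 2 → ℝ) ∈ halfBox :=
  mem_halfBox.2 fun _ => ⟨by rw [Pi.zero_apply]; linarith [Real.pi_pos], by rw [Pi.zero_apply]; linarith [Real.pi_pos]⟩

/-- The box `|kᵢ| ≤ π/4` is inside `[-π/2, π/2]²`. [folklore] -/
theorem mem_halfBox_of_abs_le {k : Fin 2 → ℝ} (hk : ∀ i, |k i| ≤ π / 4) : k ∈ halfBox :=
  mem_halfBox.2 fun i => by
    have := abs_le.1 (hk i)
    constructor <;> linarith [Real.pi_pos]

/-- **The Fermi sea is star-shaped around `0`**: for `k` on the Fermi curve (in `[-π/2, π/2]²`,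
`μ > -4`) and `0 ≤ t < 1`, `ε(t k) < μ`. [folklore] -/
theorem sqDispersion_smul_lt {μ : ℝ} (hμ : -4 < μ) {k : Fin 2 → ℝ} (hk : k ∈ halfBox) (he : sqDispersion k = μ)
    {t : ℝ} (ht0 : 0 ≤ t) (ht1 : t < 1) : sqDispersion (t • k) < μ := by
  have hconv := strictConvexOn_sqDispersion.convexOn.2 zero_mem_halfBox hk (by linarith : 0 ≤ 1 - t) ht0 (by ring)
  rw [smul_zero, zero_add, sqDispersion_zero, he, smul_eq_mul, smul_eq_mul] at hconv
  nlinarith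

/-! ### Polar parametrisation: each ray meets the Fermi curve exactly once -/

/-- **Each direction meets the Fermi curve exactly once** (the polar parametrisation
`k = p_F(θ)` of BGM (1.5)): for `-4 < μ < -2 - √2` and a direction `v` with `maxᵢ |vᵢ| = 1` there is a
unique `t ∈ (0, π/4)`… more precisely a unique `t ≥ 0` with `t ≤ π/4` and `ε(t v) = μ`, and it
satisfies `0 < t < π/4`. [cite: BenfattoGiulianiMastropietro2006, §1 (1.4)-(1.5)] -/
theorem existsUnique_fermiRadius {μ : ℝ} (hμ₁ : -4 < μ) (hμ₂ : μ < -2 - Real.sqrt 2) {v : Fin 2 → ℝ}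
    (hv : ∀ i, |v i| ≤ 1) (hv1 : ∃ i, |v i| = 1) :
    ∃! t : ℝ, (0 ≤ t ∧ t ≤ π / 4) ∧ sqDispersion (t • v) = μ := by
  have hπ := Real.pi_pos
  -- existence by the intermediate value theorem on `[0, π/4]`
  have hcont : ContinuousOn (fun t : ℝ => sqDispersion (t • v)) (Icc 0 (π / 4)) :=
    (continuous_sqDispersion.comp (continuous_id.smul continuous_const)).continuousOn
  have h0 : sqDispersion ((0 : ℝ) • v) < μ := by rw [zero_smul, sqDispersion_zero]; exact hμ₁
  have h1 : μ < sqDispersion ((π / 4) • v) := by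
    refine lt_sqDispersion_of_exists_abs_eq hμ₂ ?_
    obtain ⟨i, hi⟩ := hv1
    exact ⟨i, by rw [Pi.smul_apply, smul_eq_mul, abs_mul, hi, mul_one, abs_of_pos (by positivity)]⟩
  obtain ⟨t, ht, hte⟩ : ∃ t ∈ Ioo 0 (π / 4), sqDispersion (t • v) = μ :=
    intermediate_value_Ioo (by positivity) hcont ⟨h0, h1⟩
  refine ⟨t, ⟨⟨ht.1.le, ht.2.le⟩, hte⟩, ?_⟩
  -- uniqueness by star-shapedness
  rintro s ⟨⟨hs0, hsπ⟩, hse⟩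
  have hbox : ∀ r : ℝ, 0 ≤ r → r ≤ π / 4 → r • v ∈ halfBox := fun r hr0 hr =>
    mem_halfBox_of_abs_le fun i => by
      rw [Pi.smul_apply, smul_eq_mul, abs_mul, abs_of_nonneg hr0]
      exact (mul_le_mul hr (hv i) (abs_nonneg _) (by positivity)).trans (by rw [mul_one])
  by_contra hne
  rcases lt_or_gt_of_ne hne with hlt | hlt
  · -- s < t: s • v = (s/t) • (t • v)
    have htpos : 0 < t := ht.1
    have hlt' := sqDispersion_smul_lt hμ₁ (hbox t ht.1.le ht.2.le) hte (div_nonneg hs0 htpos.le) ((div_lt_one htpos).2 hlt)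
    rw [smul_smul, div_mul_cancel₀ _ htpos.ne', hse] at hlt'
    exact lt_irrefl _ hlt'
  · -- t < s
    have hspos : 0 < s := ht.1.trans hlt
    have hlt' := sqDispersion_smul_lt hμ₁ (hbox s hs0 hsπ) hse (div_nonneg ht.1.le hspos.le) ((div_lt_one hspos).2 hlt)
    rw [smul_smul, div_mul_cancel₀ _ hspos.ne', hte] at hlt'
    exact lt_irrefl _ hlt'

end Literature.MathematicalPhysics.QuantumLattice
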